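import Summits.QuantumFields.YangMills.Theorems.UnitScaleTiltProp7FrameRem2TopT3
import Summits.QuantumFields.YangMills.Theorems.UnitScaleTiltProp7SymFrameLinearResponseOfRegPrT3
import Summits.QuantumFields.YangMills.Theorems.UnitScaleTiltProp7SymFrameMassOfRegPrT3
import HarnessLib

/-!
# `UnitScaleTiltProp7FrameRem2OfRegPrT3` — REM2ˢ AT THE Σ∕E2E DATUM WITH `ℓ := fderiv` (R0-RECURSION file F-γ3b): the abstract-ℓ top bound ✓`Prop7FrameRem2TopT3.frameRem2_top_T3` (F-γ3a)
# instantiated at the honest linear parts `ℓ_l(x) := D[v_l(e^{·}·W♭)(x)](0)·(iD)`, `ℓY_l(b) := D[Ū⁽ˡ⁾(e^{·}·W♭)(b)](0)·(iD) · (Ūˡ[W](b))⋆`, at a printed-regular background `W ∈ 𝔘_k(e)`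
# and the Hermitian-traceless direction `D` (competitor `e^{iD}·W = emb15 W (expHermField D)`):
# **`Σ_{y : T⁽⁰⁾_n} ‖w_s(iD)(y) − 1 − D[w_s(·)(y)](0)(iD)‖ ≤ 2L·(c_B·7M₀ + c_D·A_R + 91·560L³M₀)·ℓ⁻¹ + (c_B·B_M + c_D·B_R + 91·40L²·B_M)·ℓ`** (`ℓ = L^{K−n}`, `c_B = 9L²∕2 + 171L²`, `c_D = 3L∕2`,
# `B_M = 28800L⁴·(CURL + DIV) + 600000L⁴·ℓ⁻²·M₀`) — ✓`Prop7R0OfFrameRows.sum_norm_CmapTw_sub_CmapTwS_le_of_frameRows`'s summed `hrs` row, modulo the DISPLAYED «(n3)₂-sym» rows `hR`∕`hRs`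
(route `UnitScaleTilt`, crux K1 «MinimiserStabilityRegPr» stmt-QuantumFields-19200; ★★OWNER RULINGS №19 (3)∕№20; def-free, count-neutral).
Cell `ym3-torus` (HUMAN RULING D-0037, YM ladder rung R3 — YM₃ on T³ is a rung, not d = 4, not infinite volume, not a mass gap, not Clay), width seat `ym3-torus-px13` (gen 6).

THE KNIT.  `hℓ` (the recursion of the linear parts) := ★routeR-w2 ✓`Prop7SymFrameLinearResponseOfRegPr.fderiv_frameAccU_succ_apply_covWalkSum_of_regPr` per level, its seam `hV` by ✓`Prop8Chart.coe_emlIterU_unitsField` on the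
background guard; `hℓ0` := the level-0 frames are the constant `1` (✓`frameAccU_zero`); `hM` := ✓px17 (n3) `Prop7FibreLevelMassPerLevelT3.sum_normSq_levelRatio_le_LOnly_T3`; `hΦ` := ✓px16
`Prop7SymFrameMassOfRegPr.sum_normSq_frameAccU_sub_one_le_of_regPr`; guards∕sup rows∕numerals := ✓px22 `small_iter_background_T3'`∕`small_iter_competitor_T3`, ✓px17 `chartSups`∕`supNumerals`,
✓`plaq_le_of_regPr`∕`window_weak`; the re-indexing `Site (F.P n) 0 ≃ Site (F.P K) (K − n)` := lit `siteShift (sites_eq F n K h)` with ✓`frameTwS_def`, ★routeR-w2 ✓`fderiv_frameTwS_eq_fderiv_frameAccU` (rfl) and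
✓`unitsField_toUField_emb15_expHermField`.
WHAT IS PROVED (sorry-free): `window_e12_of_e14` (the `10¹²L³e ≤ 1` window from `10¹⁴L⁹e ≤ 1`), ★★★ `sum_norm_frameTwS_sub_one_sub_fderiv_le_of_regPr` (the title).
WHAT IS DISPLAYED (OPEN, L): `hR`∕`hRs` — the «(n3)₂-sym» rows: the plain symmetric tower's single-bar SECOND-ORDER remainders `‖pertVar Ūˡ[W] Ūˡ[e^{iD}W] b − ℓY_l(b)‖ ≤ R l b` with two-slot level sums
`Σ_b R l b ≤ A_R(Lˡ)⁻¹ + B_RLˡ` (the sym twin of the route-internal row `hMcomb₂`; supplier: ✓`Prop7AvgTrueLinearisation.norm_avgFun_ratio_sub_one_sub_trueLin_le` + an ℓ¹ propagation — not in the tree).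
HONEST FRAMING.  Bookkeeping; the analytic content of REM2ˢ is the displayed `hR`∕`hRs`; nothing of (β)∕hPA2∕hcoS∕E′∕EX∕the crux is proved; rung R3, not Clay; YM gap NOT proved.  `--supports stmt-QuantumFields-19200 --as helper`.
References: T. Bałaban, CMP 98 (1985) 17–51 [Balaban1985Averaging] ((82) p.30, (97) p.32, Prop. 3 (122)–(126) p.36, Prop. 4 (134)–(135) p.38); CMP 102 (1985) 277–309 [Balaban1985Variational] ((14)–(15) p.280,
(44)–(48) p.285); CMP 109 (1987) 249–301 [Balaban1987RG1] ((0.3)–(0.4), (0.8), (0.11) pp.252–253).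
-/

set_option autoImplicit false

noncomputable section

open scoped BigOperators Matrix.Norms.L2Operator

namespace Summit.QuantumFields.YangMills.Theorems.Prop7FrameRem2OfRegPrT3

open Finset
open Literature.MathematicalPhysics.QuantumFieldTheory.Balaban1983to89
open Literature.MathematicalPhysics.QuantumFieldTheory.Balaban1983to89.T3ContinuumYM3Torus
open T4Continuum T4ReflectionCone BlockAveraging AveragingRT ExpMeanLog BlockAveragingEMLLinearisedBackground
open T3PrintedRegularMinimiser (RegPr)
open T3SectALandauChart (emb15 bgUnits)
open T3LevelShift (siteShift)
open T3PrintedRegularOrbits (sites_eq)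
open B9Eq39Adjoint (curl divB)
open B9TorusCalculus (torusT)
open B10Eq27TorusAxialLog (holT transl unitsField toUField)
open B7Prop1Explicit (expUnit disp)
open Summit.QuantumFields.YangMills.Theorems.Prop8Chart (emlIterU coe_emlIterU_unitsField)
open Summit.QuantumFields.YangMills.Theorems.Prop7TPrint (expHermField)
open Summit.QuantumFields.YangMills.Theorems.Prop7SymAvgTwSym (frameAccU frameAccU_zero frameTwS frameTwS_def)
open Summit.QuantumFields.YangMills.Theorems.Prop7SymFrameBound (bgUnits_eq_unitsField)
open Summit.QuantumFields.YangMills.Theorems.Prop7SymFrameLinearResponseStep (fderiv_frameTwS_eq_fderiv_frameAccU)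
open Summit.QuantumFields.YangMills.Theorems.Prop7SymFrameLinearResponseOfRegPr (fderiv_frameAccU_succ_apply_covWalkSum_of_regPr)
open Summit.QuantumFields.YangMills.Theorems.Prop7SymFrameMassOfRegPr (sum_normSq_frameAccU_sub_one_le_of_regPr)
open Summit.QuantumFields.YangMills.Theorems.Prop7CompetitorGuardOfLevelSups (small_iter_competitor_T3 small_iter_background_T3')
open Summit.QuantumFields.YangMills.Theorems.Prop7JointRowTowerData (chartSups supNumerals)
open Summit.QuantumFields.YangMills.Theorems.Prop7TwistedLevelMassOfRegPr (plaq_le_of_regPr window_weak)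
open Summit.QuantumFields.YangMills.Theorems.Prop7Chart48SymUntwisted (unitsField_toUField_emb15_expHermField)
open Summit.QuantumFields.YangMills.Theorems.Prop7FrameRem2TopT3 (frameRem2_top_T3)

section T3

variable (F : T3Family) (n K : ℕ)

/-- the routeR-w2 window `10¹²L³e ≤ 1` from the Σ∕E2E window `10¹⁴L⁹e ≤ 1` (`L ≥ 3`). [cite: Balaban1985Variational, (14)-(15) p.280] -/
theorem window_e12_of_e14 {e : ℝ} (he : 0 < e) (heL : 100000000000000 * (F.L : ℝ) ^ 9 * e ≤ 1) : 10 ^ 12 * (F.L : ℝ) ^ 3 * e ≤ 1 := by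
  have hL3 : (3 : ℝ) ≤ F.L := Prop7CurvedLandauKnitT3.three_le_L F
  have hL1 : (1 : ℝ) ≤ F.L := by linarith
  have hpow : (F.L : ℝ) ^ 3 ≤ (F.L : ℝ) ^ 9 := pow_le_pow_right₀ hL1 (by norm_num)
  have h3 : (0 : ℝ) ≤ (F.L : ℝ) ^ 3 := by positivity
  nlinarith [mul_le_mul_of_nonneg_right hpow he.le]

variable {F n K}

/-- ★★★ **REM2ˢ AT THE Σ∕E2E DATUM, `ℓ := fderiv`** — the summed `hrs` row of ✓`Prop7R0OfFrameRows.sum_norm_CmapTw_sub_CmapTwS_le_of_frameRows` modulo the displayed «(n3)₂-sym» rows `hR`∕`hRs`: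
for `W ∈ 𝔘_k(e)` (`RegPr F n K e W`), `D` Hermitian traceless with `‖D b‖ ≤ s`, windows `10¹⁴L⁹e ≤ 1`, `4s ≤ 1`, `4·10¹¹L⁹(ℓs) ≤ 1`,
`Σ_{y : Site (F.P n) 0} ‖↑(frameTwS F n K h W (I•D) y) − 1 − fderiv ℂ (A ↦ ↑(frameTwS F n K h W A y)) 0 (I•D)‖ ≤ 2L·((9L²∕2 + 171L²)·(7M₀) + (3L∕2)·A_R + 91·(2L·40L²·(7M₀)))·(L^{K−n})⁻¹
+ ((9L²∕2 + 171L²)·B_M + (3L∕2)·B_R + 91·(40L²·B_M))·L^{K−n}`, `M₀ = Σ_b‖pertVar W (e^{iD}W) b‖²`, `B_M = 28800L⁴·(CURL + DIV) + 600000L⁴·(ℓ²)⁻¹·M₀` (✓F-γ3a ∘ ★routeR-w2's `ℓ`-recursion ∘ (n3) ∘ ✓px16 Φˢ).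
[cite: Balaban1985Averaging, (82) p.30, (97) p.32, Prop. 3 (122)-(126) p.36, Prop. 4 (134)-(135) p.38; Balaban1985Variational, (14)-(15) p.280, (44)-(48) p.285; Balaban1987RG1, (0.4), (0.8), (0.11) p.253] -/
theorem sum_norm_frameTwS_sub_one_sub_fderiv_le_of_regPr (h : n ≤ K) {e s : ℝ} (he : 0 < e) (heL : 100000000000000 * (F.L : ℝ) ^ 9 * e ≤ 1)
    (hs0 : 0 ≤ s) (hs4 : 4 * s ≤ 1) (hsL : 400000000000 * (F.L : ℝ) ^ 9 * (((F.L : ℝ) ^ (K - n)) * s) ≤ 1)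
    {W : GaugeField (F.P K) 0 (Matrix.specialUnitaryGroup (Fin 2) ℂ)} (hreg : RegPr F n K e W)
    (D : PBond (F.P K) 0 → Matrix (Fin 2) (Fin 2) ℂ) (hD : ∀ b : PBond (F.P K) 0, (D b).IsHermitian ∧ Matrix.trace (D b) = 0)
    (hs : ∀ b : PBond (F.P K) 0, ‖D b‖ ≤ s)
    (R : (l : ℕ) → PBond (F.P K) l → ℝ) (hR0 : ∀ l b, 0 ≤ R l b)
    (hR : ∀ l, l < K - n → ∀ b : PBond (F.P K) l,
      ‖pertVar (Averaging.iter (fun i => blockAvg (P := (F.P K)) (j := i) (expMeanLogSU (n := Fin 2))) l W)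
            (Averaging.iter (fun i => blockAvg (P := (F.P K)) (j := i) (expMeanLogSU (n := Fin 2))) l (emb15 W (expHermField D))) b
        - fderiv ℂ (fun t : PBond (F.P K) 0 → Matrix (Fin 2) (Fin 2) ℂ =>
            ((emlIterU l (fun b' => expUnit (t b') * bgUnits F K W b') b : (Matrix (Fin 2) (Fin 2) ℂ)ˣ) : Matrix (Fin 2) (Fin 2) ℂ)) 0 (fun b' => Complex.I • D b')
          * star ((Averaging.iter (fun i => blockAvg (P := (F.P K)) (j := i) (expMeanLogSU (n := Fin 2))) l W b : Matrix.specialUnitaryGroup (Fin 2) ℂ) : Matrix (Fin 2) (Fin 2) ℂ)‖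
        ≤ R l b)
    {AR BR : ℝ} (hAR : 0 ≤ AR) (hBR : 0 ≤ BR)
    (hRs : ∀ l ≤ K - n, ∑ b : PBond (F.P K) l, R l b ≤ AR * ((F.L : ℝ) ^ l)⁻¹ + BR * (F.L : ℝ) ^ l) :
    ∑ y : Site (F.P n) 0, ‖((frameTwS F n K h W (fun b => Complex.I • D b) y : (Matrix (Fin 2) (Fin 2) ℂ)ˣ) : Matrix (Fin 2) (Fin 2) ℂ) - 1
        - fderiv ℂ (fun A : PBond (F.P K) 0 → Matrix (Fin 2) (Fin 2) ℂ => ((frameTwS F n K h W A y : (Matrix (Fin 2) (Fin 2) ℂ)ˣ) : Matrix (Fin 2) (Fin 2) ℂ)) 0 (fun b => Complex.I • D b)‖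
      ≤ 2 * (F.L : ℝ) * ((9 * (F.L : ℝ) ^ 2 / 2 + 171 * (F.L : ℝ) ^ 2) * (7 * (∑ b : PBond (F.P K) 0, ‖pertVar W (emb15 W (expHermField D)) b‖ ^ 2))
          + 3 * (F.L : ℝ) / 2 * AR
          + 91 * (2 * (F.L : ℝ) * (40 * (F.L : ℝ) ^ 2) * (7 * (∑ b : PBond (F.P K) 0, ‖pertVar W (emb15 W (expHermField D)) b‖ ^ 2)))) * ((F.L : ℝ) ^ (K - n))⁻¹
        + ((9 * (F.L : ℝ) ^ 2 / 2 + 171 * (F.L : ℝ) ^ 2) * (28800 * (F.L : ℝ) ^ 4 * ((∑ x : Site (F.P K) 0, ∑ μ : Fin (F.P K).d, ∑ ν : Fin (F.P K).d,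
            (if μ < ν then ∑ j : Fin 2, ∑ k : Fin 2,
              ‖(curl (torusT (F.P K) 0) (fun κ z => unitsField (toUField W) ⟨z, κ⟩) (fun κ z => pertVar W (emb15 W (expHermField D)) ⟨z, κ⟩) μ ν x) j k‖ ^ 2 else 0)) + (∑ x : Site (F.P K) 0, ∑ j : Fin 2, ∑ k : Fin 2,
            ‖(divB (torusT (F.P K) 0) (fun κ z => unitsField (toUField W) ⟨z, κ⟩) (fun κ z => pertVar W (emb15 W (expHermField D)) ⟨z, κ⟩) x) j k‖ ^ 2))
            + 600000 * (F.L : ℝ) ^ 4 * (((F.L : ℝ) ^ (K - n)) ^ 2)⁻¹ * (∑ b : PBond (F.P K) 0, ‖pertVar W (emb15 W (expHermField D)) b‖ ^ 2))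
          + 3 * (F.L : ℝ) / 2 * BR
          + 91 * (40 * (F.L : ℝ) ^ 2 * (28800 * (F.L : ℝ) ^ 4 * ((∑ x : Site (F.P K) 0, ∑ μ : Fin (F.P K).d, ∑ ν : Fin (F.P K).d,
            (if μ < ν then ∑ j : Fin 2, ∑ k : Fin 2,
              ‖(curl (torusT (F.P K) 0) (fun κ z => unitsField (toUField W) ⟨z, κ⟩) (fun κ z => pertVar W (emb15 W (expHermField D)) ⟨z, κ⟩) μ ν x) j k‖ ^ 2 else 0)) + (∑ x : Site (F.P K) 0, ∑ j : Fin 2, ∑ k : Fin 2,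
            ‖(divB (torusT (F.P K) 0) (fun κ z => unitsField (toUField W) ⟨z, κ⟩) (fun κ z => pertVar W (emb15 W (expHermField D)) ⟨z, κ⟩) x) j k‖ ^ 2))
            + 600000 * (F.L : ℝ) ^ 4 * (((F.L : ℝ) ^ (K - n)) ^ 2)⁻¹ * (∑ b : PBond (F.P K) 0, ‖pertVar W (emb15 W (expHermField D)) b‖ ^ 2)))) * (F.L : ℝ) ^ (K - n) := by
  have hL3 : (3 : ℝ) ≤ F.L := Prop7CurvedLandauKnitT3.three_le_L F
  have hL0 : (0 : ℝ) < F.L := by linarith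
  have heL' := window_weak F he heL
  have he12 := window_e12_of_e14 F he heL
  have hUe := plaq_le_of_regPr F n K hreg
  -- the sup rows and their numerals (px17), the two (0.4) guards (px22)
  obtain ⟨-, hμ⟩ := chartSups F n K he heL hs0 hs4 hsL hreg D hD hs
  obtain ⟨-, hμ0, hμ72, hμN, hμθ, hθ0, hθL⟩ := supNumerals F n K hs0 hsL
  have hU₀g := small_iter_background_T3' F n K W he heL' hUe
  have hWg := small_iter_competitor_T3 F n K W (emb15 W (expHermField D)) he heL' hUe (fun j : ℕ => 480 * (F.L : ℝ) ^ 4 * (F.L : ℝ) ^ j * s) hμ0 hμ hμ72 hμN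
  -- the tower seam on the background guard: `emlIterU l W♭ = (Ūˡ[W])♭`
  have hV : ∀ l, l ≤ K - n → ∀ b : PBond (F.P K) l,
      ((emlIterU l (bgUnits F K W) b : (Matrix (Fin 2) (Fin 2) ℂ)ˣ) : Matrix (Fin 2) (Fin 2) ℂ)
        = ((Averaging.iter (fun i => blockAvg (P := (F.P K)) (j := i) (expMeanLogSU (n := Fin 2))) l W b : Matrix.specialUnitaryGroup (Fin 2) ℂ) : Matrix (Fin 2) (Fin 2) ℂ) :=
    fun l hl b => coe_emlIterU_unitsField W (K - n) hU₀g l hl b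
  -- (n3), Φˢ
  have hM := Prop7FibreLevelMassPerLevelT3.sum_normSq_levelRatio_le_LOnly_T3 F n K W (emb15 W (expHermField D)) he heL' hUe
    (fun j : ℕ => 480 * (F.L : ℝ) ^ 4 * (F.L : ℝ) ^ j * s) hμ0 hμ hμ72 hμN hθ0 hμθ hθL
  have hΦ' := sum_normSq_frameAccU_sub_one_le_of_regPr F n K he heL hs0 hs4 hsL hreg D hD hs
  have hM₀ : 0 ≤ ∑ b : PBond (F.P K) 0, ‖pertVar W (emb15 W (expHermField D)) b‖ ^ 2 := Finset.sum_nonneg fun _ _ => sq_nonneg _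
  have hBM : 0 ≤ 28800 * (F.L : ℝ) ^ 4 * ((∑ x : Site (F.P K) 0, ∑ μ : Fin (F.P K).d, ∑ ν : Fin (F.P K).d,
            (if μ < ν then ∑ j : Fin 2, ∑ k : Fin 2,
              ‖(curl (torusT (F.P K) 0) (fun κ z => unitsField (toUField W) ⟨z, κ⟩) (fun κ z => pertVar W (emb15 W (expHermField D)) ⟨z, κ⟩) μ ν x) j k‖ ^ 2 else 0)) + (∑ x : Site (F.P K) 0, ∑ j : Fin 2, ∑ k : Fin 2,
            ‖(divB (torusT (F.P K) 0) (fun κ z => unitsField (toUField W) ⟨z, κ⟩) (fun κ z => pertVar W (emb15 W (expHermField D)) ⟨z, κ⟩) x) j k‖ ^ 2))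
            + 600000 * (F.L : ℝ) ^ 4 * (((F.L : ℝ) ^ (K - n)) ^ 2)⁻¹ * (∑ b : PBond (F.P K) 0, ‖pertVar W (emb15 W (expHermField D)) b‖ ^ 2) := by positivity
  -- F-γ3a at `ℓ := fderiv`
  have hTop := frameRem2_top_T3 (AΦ := 2 * (F.L : ℝ) * (40 * (F.L : ℝ) ^ 2) * (7 * (∑ b : PBond (F.P K) 0, ‖pertVar W (emb15 W (expHermField D)) b‖ ^ 2)))
    (BΦ := 40 * (F.L : ℝ) ^ 2 * (28800 * (F.L : ℝ) ^ 4 * ((∑ x : Site (F.P K) 0, ∑ μ : Fin (F.P K).d, ∑ ν : Fin (F.P K).d,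
            (if μ < ν then ∑ j : Fin 2, ∑ k : Fin 2,
              ‖(curl (torusT (F.P K) 0) (fun κ z => unitsField (toUField W) ⟨z, κ⟩) (fun κ z => pertVar W (emb15 W (expHermField D)) ⟨z, κ⟩) μ ν x) j k‖ ^ 2 else 0)) + (∑ x : Site (F.P K) 0, ∑ j : Fin 2, ∑ k : Fin 2,
            ‖(divB (torusT (F.P K) 0) (fun κ z => unitsField (toUField W) ⟨z, κ⟩) (fun κ z => pertVar W (emb15 W (expHermField D)) ⟨z, κ⟩) x) j k‖ ^ 2))
            + 600000 * (F.L : ℝ) ^ 4 * (((F.L : ℝ) ^ (K - n)) ^ 2)⁻¹ * (∑ b : PBond (F.P K) 0, ‖pertVar W (emb15 W (expHermField D)) b‖ ^ 2)))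
    F n K W (emb15 W (expHermField D)) hU₀g hWg (fun j : ℕ => 480 * (F.L : ℝ) ^ 4 * (F.L : ℝ) ^ j * s) hμ hμ72 hθ0 hμθ hθL
    (fun l x => fderiv ℂ (fun t : PBond (F.P K) 0 → Matrix (Fin 2) (Fin 2) ℂ =>
        ((frameAccU l (bgUnits F K W) (fun b => expUnit (t b) * bgUnits F K W b) x : (Matrix (Fin 2) (Fin 2) ℂ)ˣ) : Matrix (Fin 2) (Fin 2) ℂ)) 0 (fun b => Complex.I • D b))
    (fun l b => fderiv ℂ (fun t : PBond (F.P K) 0 → Matrix (Fin 2) (Fin 2) ℂ =>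
        ((emlIterU l (fun b' => expUnit (t b') * bgUnits F K W b') b : (Matrix (Fin 2) (Fin 2) ℂ)ˣ) : Matrix (Fin 2) (Fin 2) ℂ)) 0 (fun b' => Complex.I • D b')
          * star ((Averaging.iter (fun i => blockAvg (P := (F.P K)) (j := i) (expMeanLogSU (n := Fin 2))) l W b : Matrix.specialUnitaryGroup (Fin 2) ℂ) : Matrix (Fin 2) (Fin 2) ℂ))
    (fun x => by simp [frameAccU_zero])
    (fun l hl y => fderiv_frameAccU_succ_apply_covWalkSum_of_regPr he he12 W hreg hl _ (hV l hl.le) y _)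
    R hR0 hR (by positivity) hBM hAR hBR (by positivity) (by positivity) hM hRs
    (fun l hl => (hΦ' l hl).trans_eq (by ring))
  -- re-index `Site (F.P n) 0 ≃ Site (F.P K) (K − n)` and read `frameTwS` in the generic letters
  have hfield : (fun b : PBond (F.P K) 0 => expUnit (Complex.I • D b) * bgUnits F K W b) = unitsField (toUField (emb15 W (expHermField D))) :=
    (unitsField_toUField_emb15_expHermField (F := F) (K := K) W D hD).symm
  have hsum : ∑ y : Site (F.P n) 0, ‖((frameTwS F n K h W (fun b => Complex.I • D b) y : (Matrix (Fin 2) (Fin 2) ℂ)ˣ) : Matrix (Fin 2) (Fin 2) ℂ) - 1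
        - fderiv ℂ (fun A : PBond (F.P K) 0 → Matrix (Fin 2) (Fin 2) ℂ => ((frameTwS F n K h W A y : (Matrix (Fin 2) (Fin 2) ℂ)ˣ) : Matrix (Fin 2) (Fin 2) ℂ)) 0 (fun b => Complex.I • D b)‖
      = ∑ x : Site (F.P K) (K - n), ‖((frameAccU (K - n) (unitsField (toUField W)) (unitsField (toUField (emb15 W (expHermField D)))) x : (Matrix (Fin 2) (Fin 2) ℂ)ˣ) : Matrix (Fin 2) (Fin 2) ℂ) - 1
        - fderiv ℂ (fun t : PBond (F.P K) 0 → Matrix (Fin 2) (Fin 2) ℂ =>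
            ((frameAccU (K - n) (bgUnits F K W) (fun b => expUnit (t b) * bgUnits F K W b) x : (Matrix (Fin 2) (Fin 2) ℂ)ˣ) : Matrix (Fin 2) (Fin 2) ℂ)) 0 (fun b => Complex.I • D b)‖ := by
    refine Fintype.sum_equiv (siteShift (sites_eq F n K h)) _ _ fun y => ?_
    rw [fderiv_frameTwS_eq_fderiv_frameAccU, frameTwS_def, hfield]
    rfl
  rw [hsum]
  exact hTop

end T3

end Summit.QuantumFields.YangMills.Theorems.Prop7FrameRem2OfRegPrT3

end
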